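import Mathlib

/-!
# Stub `stub_twoLoopStepLaw` (crux `FemtoCurvatureTwoPointC`, line Sketch, calculus B)

Pure real analysis. The explicit two-loop running coupling is `u L β = (ψ (T L β))⁻¹` with
`T L β = Y β - 2 b₀ log (L / 8)`, `Y β = y - q log (y + q)`, `y = max (κ β + c₀) 1`, and
`ψ t = (1 + q) exp (min t 0) + max t 0 + q (log (max t 0 + e) - 1)`.

We prove in-window comparability `|u(L,β)⁻¹ - u(L',β)⁻¹| ≤ κ₂` for `8 ≤ L ≤ L' ≤ 2L` and the
two-sided dyadic step law `κ₁ m ≤ u(8·2ᵏ,β)⁻¹ - u(8·2ᵏ⁺ᵐ,β)⁻¹ ≤ κ₂ m`, with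
`κ₁ = 2 b₀ log 2` and `κ₂ = 2 b₀ log 2 · (1 + q)`.

Proof idea: for `t ≥ 0`, `ψ t = 1 + t + q log (t + e)`; `ψ > 0` and `ψ t ≤ ψ c` whenever `t ≤ c`,
`0 ≤ c`. The window condition `u ≤ u₀` with `u₀ ψ (2 b₀ log 2) < 1` forces `T > 2 b₀ log 2 > 0`,
so all relevant values of `T` lie in the regime `t ≥ 0`, where for `0 ≤ s ≤ t` one has
`t - s ≤ ψ t - ψ s ≤ (1 + q) (t - s)` (using `log x ≤ x - 1`). Finally
`T (8·2ᵏ) β - T (8·2ᵏ⁺ᵐ) β = 2 b₀ m log 2` and `0 ≤ T L β - T L' β ≤ 2 b₀ log 2` in the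
comparability window.
-/

set_option autoImplicit false

namespace Summit.QuantumFields.YangMills.Theorems.FemtoCurvatureTwoPointC

/-- The explicit two-loop shape function in the regime `t ≥ 0`: `ψ t = 1 + t + q log (t + e)`. -/
theorem stepLaw_psi_eq_of_nonneg (q t : ℝ) (ht : 0 ≤ t) :
    (1 + q) * Real.exp (min t 0) + max t 0 + q * (Real.log (max t 0 + Real.exp 1) - 1) =
      1 + t + q * Real.log (t + Real.exp 1) := by
  rw [min_eq_right ht, max_eq_left ht, Real.exp_zero]
  ring

/-- The explicit two-loop shape function in the regime `t < 0`: `ψ t = (1 + q) exp t`. -/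
theorem stepLaw_psi_eq_of_neg (q t : ℝ) (ht : t < 0) :
    (1 + q) * Real.exp (min t 0) + max t 0 + q * (Real.log (max t 0 + Real.exp 1) - 1) =
      (1 + q) * Real.exp t := by
  rw [min_eq_left ht.le, max_eq_right ht.le, zero_add, Real.log_exp]
  ring

/-- The shape function `ψ` is everywhere positive (for `q ≥ 0`). -/
theorem stepLaw_psi_pos (q : ℝ) (hq : 0 ≤ q) (ψ : ℝ → ℝ)
    (hψ : ∀ t, ψ t =
      (1 + q) * Real.exp (min t 0) + max t 0 + q * (Real.log (max t 0 + Real.exp 1) - 1))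
    (t : ℝ) : 0 < ψ t := by
  rcases lt_or_ge t 0 with ht | ht
  · rw [hψ, stepLaw_psi_eq_of_neg q t ht]
    exact mul_pos (by linarith) (Real.exp_pos t)
  · rw [hψ, stepLaw_psi_eq_of_nonneg q t ht]
    have he : 1 ≤ Real.exp 1 := by linarith [Real.add_one_le_exp (1 : ℝ)]
    have h1 : 0 ≤ Real.log (t + Real.exp 1) := Real.log_nonneg (by linarith)
    have h2 : 0 ≤ q * Real.log (t + Real.exp 1) := mul_nonneg hq h1
    linarith

/-- Monotone bound: if `t ≤ c` and `0 ≤ c` then `ψ t ≤ ψ c = 1 + c + q log (c + e)`. -/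
theorem stepLaw_psi_le_of_le (q : ℝ) (hq : 0 ≤ q) (ψ : ℝ → ℝ)
    (hψ : ∀ t, ψ t =
      (1 + q) * Real.exp (min t 0) + max t 0 + q * (Real.log (max t 0 + Real.exp 1) - 1))
    (t c : ℝ) (hc : 0 ≤ c) (htc : t ≤ c) :
    ψ t ≤ 1 + c + q * Real.log (c + Real.exp 1) := by
  have he : 1 ≤ Real.exp 1 := by linarith [Real.add_one_le_exp (1 : ℝ)]
  have hlog1 : 1 ≤ Real.log (c + Real.exp 1) := by
    have h := Real.log_le_log (Real.exp_pos 1) (by linarith : Real.exp 1 ≤ c + Real.exp 1)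
    rwa [Real.log_exp] at h
  rcases lt_or_ge t 0 with ht | ht
  · rw [hψ, stepLaw_psi_eq_of_neg q t ht]
    have h1 : Real.exp t ≤ 1 := Real.exp_le_one_iff.mpr ht.le
    have h2 : (1 + q) * Real.exp t ≤ (1 + q) * 1 := mul_le_mul_of_nonneg_left h1 (by linarith)
    have h3 : q * 1 ≤ q * Real.log (c + Real.exp 1) := mul_le_mul_of_nonneg_left hlog1 hq
    linarith
  · rw [hψ, stepLaw_psi_eq_of_nonneg q t ht]
    have h1 : Real.log (t + Real.exp 1) ≤ Real.log (c + Real.exp 1) :=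
      Real.log_le_log (by linarith) (by linarith)
    have h2 : q * Real.log (t + Real.exp 1) ≤ q * Real.log (c + Real.exp 1) :=
      mul_le_mul_of_nonneg_left h1 hq
    linarith

/-- Window forces the perturbative regime: if `u₀ ψ c < 1` (`c ≥ 0`) and `(ψ t)⁻¹ ≤ u₀`, then
`c < t`. -/
theorem stepLaw_window (q u₀ c : ℝ) (hq : 0 ≤ q) (hu₀ : 0 < u₀) (hc : 0 ≤ c) (ψ : ℝ → ℝ)
    (hψ : ∀ t, ψ t =
      (1 + q) * Real.exp (min t 0) + max t 0 + q * (Real.log (max t 0 + Real.exp 1) - 1))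
    (h₀ : u₀ * (1 + c + q * Real.log (c + Real.exp 1)) < 1) (t : ℝ) (ht : (ψ t)⁻¹ ≤ u₀) :
    c < t := by
  by_contra hct
  have htc : t ≤ c := le_of_not_gt hct
  have h1 : ψ t ≤ 1 + c + q * Real.log (c + Real.exp 1) :=
    stepLaw_psi_le_of_le q hq ψ hψ t c hc htc
  have hpos : 0 < ψ t := stepLaw_psi_pos q hq ψ hψ t
  have h3 : 1 ≤ ψ t * u₀ := by
    have h := mul_le_mul_of_nonneg_left ht hpos.le
    rwa [mul_inv_cancel₀ hpos.ne'] at h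
  have h4 : ψ t * u₀ ≤ (1 + c + q * Real.log (c + Real.exp 1)) * u₀ :=
    mul_le_mul_of_nonneg_right h1 hu₀.le
  linarith

/-- Two-sided increment bound in the regime `0 ≤ s`, `t - s = d ≥ 0`:
`d ≤ ψ t - ψ s ≤ (1 + q) d`. -/
theorem stepLaw_psi_sub_bounds (q : ℝ) (hq : 0 ≤ q) (ψ : ℝ → ℝ)
    (hψ : ∀ t, ψ t =
      (1 + q) * Real.exp (min t 0) + max t 0 + q * (Real.log (max t 0 + Real.exp 1) - 1))
    (s t d : ℝ) (hs : 0 ≤ s) (hd : 0 ≤ d) (hts : t - s = d) :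
    d ≤ ψ t - ψ s ∧ ψ t - ψ s ≤ (1 + q) * d := by
  subst hts
  have he : 1 ≤ Real.exp 1 := by linarith [Real.add_one_le_exp (1 : ℝ)]
  have hst : s ≤ t := by linarith
  have hse : 0 < s + Real.exp 1 := by linarith
  have hte : 0 < t + Real.exp 1 := by linarith
  rw [hψ t, hψ s, stepLaw_psi_eq_of_nonneg q t (hs.trans hst), stepLaw_psi_eq_of_nonneg q s hs]
  have hlog1 : Real.log (s + Real.exp 1) ≤ Real.log (t + Real.exp 1) :=
    Real.log_le_log hse (by linarith)
  have hlog2 : Real.log (t + Real.exp 1) - Real.log (s + Real.exp 1) ≤ t - s := by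
    rw [← Real.log_div hte.ne' hse.ne']
    calc Real.log ((t + Real.exp 1) / (s + Real.exp 1))
        ≤ (t + Real.exp 1) / (s + Real.exp 1) - 1 := Real.log_le_sub_one_of_pos (div_pos hte hse)
      _ = (t - s) / (s + Real.exp 1) := by
          field_simp
          ring
      _ ≤ t - s := div_le_self (sub_nonneg.2 hst) (by linarith)
  have h1 : q * Real.log (s + Real.exp 1) ≤ q * Real.log (t + Real.exp 1) :=
    mul_le_mul_of_nonneg_left hlog1 hq
  have h2 : q * (Real.log (t + Real.exp 1) - Real.log (s + Real.exp 1)) ≤ q * (t - s) :=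
    mul_le_mul_of_nonneg_left hlog2 hq
  constructor
  · linarith
  · linarith

/-- **Calculus B** (stub `stub_twoLoopStepLaw` of line Sketch): in-window comparability and the
two-sided dyadic asymptotic-freedom step law for the explicit two-loop running coupling
`u = ψ(T)⁻¹`, with `κ₁ = 2 b₀ log 2` and `κ₂ = 2 b₀ log 2 · (1 + q)`. -/
theorem stub_twoLoopStepLaw :
    ∀ (κ c₀ b₀ q u₀ : ℝ), 0 < b₀ → 0 ≤ q → 0 < u₀ →
      u₀ * (1 + 2 * b₀ * Real.log 2 + q * Real.log (2 * b₀ * Real.log 2 + Real.exp 1)) < 1 →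
      ∀ (T u : ℕ → ℝ → ℝ),
        (T = fun (L : ℕ) (β : ℝ) => max (κ * β + c₀) 1 - q * Real.log (max (κ * β + c₀) 1 + q) -
            2 * b₀ * Real.log ((L : ℝ) / 8)) →
        (u = fun (L : ℕ) (β : ℝ) => ((1 + q) * Real.exp (min (T L β) 0) + max (T L β) 0 +
            q * (Real.log (max (T L β) 0 + Real.exp 1) - 1))⁻¹) →
        ∃ κ₁ κ₂ : ℝ, 0 < κ₁ ∧
          (∀ (L L' : ℕ) (β : ℝ), 8 ≤ L → L ≤ L' → L' ≤ 2 * L → u L β ≤ u₀ →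
              |(u L β)⁻¹ - (u L' β)⁻¹| ≤ κ₂) ∧
          (∀ (k m : ℕ) (β : ℝ), u (8 * 2 ^ (k + m)) β ≤ u₀ →
              κ₁ * m ≤ (u (8 * 2 ^ k) β)⁻¹ - (u (8 * 2 ^ (k + m)) β)⁻¹ ∧
                (u (8 * 2 ^ k) β)⁻¹ - (u (8 * 2 ^ (k + m)) β)⁻¹ ≤ κ₂ * m) := by
  intro κ c₀ b₀ q u₀ hb₀ hq hu₀ h₀ T u hT hu
  obtain ⟨ψ, hψ⟩ : ∃ ψ : ℝ → ℝ, ∀ t, ψ t =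
      (1 + q) * Real.exp (min t 0) + max t 0 + q * (Real.log (max t 0 + Real.exp 1) - 1) :=
    ⟨fun t => (1 + q) * Real.exp (min t 0) + max t 0 + q * (Real.log (max t 0 + Real.exp 1) - 1),
      fun _ => rfl⟩
  have hlog2 : 0 < Real.log 2 := Real.log_pos (by norm_num)
  have hc : 0 < 2 * b₀ * Real.log 2 := mul_pos (mul_pos two_pos hb₀) hlog2
  have hu' : ∀ (L : ℕ) (β : ℝ), u L β = (ψ (T L β))⁻¹ := fun L β => by simp only [hu, hψ]
  have huψ : ∀ (L : ℕ) (β : ℝ), (u L β)⁻¹ = ψ (T L β) := fun L β => by rw [hu', inv_inv]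
  have hTd : ∀ (L L' : ℕ) (β : ℝ),
      T L β - T L' β = 2 * b₀ * (Real.log ((L' : ℝ) / 8) - Real.log ((L : ℝ) / 8)) :=
    fun L L' β => by simp only [hT]; ring
  have hwin : ∀ (L : ℕ) (β : ℝ), u L β ≤ u₀ → 2 * b₀ * Real.log 2 < T L β := fun L β h =>
    stepLaw_window q u₀ (2 * b₀ * Real.log 2) hq hu₀ hc.le ψ hψ h₀ (T L β) (by rw [← hu']; exact h)
  refine ⟨2 * b₀ * Real.log 2, 2 * b₀ * Real.log 2 * (1 + q), hc, ?_, ?_⟩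
  · intro L L' β hL hLL' hL2 huL
    have hLr : (8 : ℝ) ≤ L := by exact_mod_cast hL
    have hLL'r : (L : ℝ) ≤ L' := by exact_mod_cast hLL'
    have hL2r : (L' : ℝ) ≤ 2 * L := by exact_mod_cast hL2
    have hL8 : (0 : ℝ) < L / 8 := by linarith
    have hlow : Real.log ((L : ℝ) / 8) ≤ Real.log ((L' : ℝ) / 8) :=
      Real.log_le_log hL8 (by linarith)
    have hup : Real.log ((L' : ℝ) / 8) ≤ Real.log 2 + Real.log ((L : ℝ) / 8) := by
      rw [← Real.log_mul two_ne_zero hL8.ne']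
      exact Real.log_le_log (by linarith) (by linarith)
    have ht : 2 * b₀ * Real.log 2 < T L β := hwin L β huL
    have hd0 : 0 ≤ T L β - T L' β := by
      rw [hTd]
      exact mul_nonneg (by positivity) (by linarith)
    have hd1 : T L β - T L' β ≤ 2 * b₀ * Real.log 2 := by
      rw [hTd]
      exact mul_le_mul_of_nonneg_left (by linarith) (by positivity)
    obtain ⟨hlo, hhi⟩ := stepLaw_psi_sub_bounds q hq ψ hψ (T L' β) (T L β) (T L β - T L' β)
      (by linarith) hd0 rfl
    have hhi' : (1 + q) * (T L β - T L' β) ≤ (1 + q) * (2 * b₀ * Real.log 2) :=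
      mul_le_mul_of_nonneg_left hd1 (by linarith)
    rw [huψ, huψ, abs_of_nonneg (by linarith)]
    linarith
  · intro k m β hkm
    have hlogd : ∀ n : ℕ, Real.log (((8 * 2 ^ n : ℕ) : ℝ) / 8) = (n : ℝ) * Real.log 2 := by
      intro n
      have h : ((8 * 2 ^ n : ℕ) : ℝ) / 8 = 2 ^ n := by
        push_cast
        ring
      rw [h, Real.log_pow]
    have hd : T (8 * 2 ^ k) β - T (8 * 2 ^ (k + m)) β = 2 * b₀ * Real.log 2 * m := by
      rw [hTd, hlogd, hlogd]
      push_cast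
      ring
    have hs : 2 * b₀ * Real.log 2 < T (8 * 2 ^ (k + m)) β := hwin _ β hkm
    have hdnn : 0 ≤ 2 * b₀ * Real.log 2 * m := by positivity
    obtain ⟨hlo, hhi⟩ := stepLaw_psi_sub_bounds q hq ψ hψ (T (8 * 2 ^ (k + m)) β) (T (8 * 2 ^ k) β)
      (2 * b₀ * Real.log 2 * m) (by linarith) hdnn hd
    rw [huψ, huψ]
    exact ⟨hlo, by linarith⟩

end Summit.QuantumFields.YangMills.Theorems.FemtoCurvatureTwoPointC
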